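import Literature.AlgebraicGeometry.ComplexMultiplication.OneTypeEigensystemCMHodgeMorphism
import Literature.AlgebraicGeometry.Motives.HodgeStructureEndAlgDiagonalization
import Mathlib.FieldTheory.PrimitiveElement
import HarnessLib

/-!
# One-type eigenblocks: restricting the eigenvalue-field action to a subfield along which the sign pattern is
# induced keeps the all-or-nothing property (CM-type inflation `Φ = e^* Ψ`, Shimura 1998 §8.3 / Deligne LNM 900 §5)

Family `hodge`, layer `Literature/AlgebraicGeometry/ComplexMultiplication`; THEOREMS ONLY (no definition, no named
fact — D-0026).  Sequel of `OneTypeEigensystemCMHodgeMorphism` (abstract weight-one Hodge structure `H` on a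
finite-dimensional `ℚ`-space `V`, commutative `act : R →ₐ[ℚ] End_ℚ V`, occurring eigensystem `t`, one-type hypothesis
`hall`; eigenblock `W(t)`, eigenvalue field `E(t)`, action `ρ = eigenfieldAction`).

SITUATION (route R-A of the cell `pub-hodgecm2`, `pub-hodgecm2-s2crux-idea-2/ROUTES.md` v2.0 §R-A and `RA-Sketch.lean`
b2457b5f3b09, binder (HE) `HeckeReflexEigenblock`): the automorphic side produces a Hecke eigenblock `W(t)` whose
eigenvalue field `E(t) = ℚ(χ_ξ)` CONTAINS a smaller CM field `K` (there: the reflex field `K*_Θ`) along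
`e : K → E(t)`, with the sign pattern of `t` INDUCED from a CM type `Ψ` of `K`:
`τ` is of type `(1,0)` iff `τ ∘ e ∈ Ψ`.  (HE) asks for the `K`-block `(W, ρ ∘ e)` to be ALL-OR-NOTHING: every
`σ`-eigenvector of `K` (`σ : K → ℂ`) is of type `(1,0)` if `σ ∈ Ψ` and of type `(0,1)` if `σ ∉ Ψ`.  This file proves
exactly that passage, in the abstract-carrier vocabulary (`H.piece 1 0` / `H.piece 0 1`):

* `oneType_restrict_subfield` — for `y ∈ ℂ ⊗ W(t)` with `ρ(e b)_ℂ y = σ(b) y` for all `b ∈ K`: `(W ↪ V)_ℂ y ∈ V^{1,0}` if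
  `σ ∈ Ψ`, `∈ V^{0,1}` if `σ ∉ Ψ`.  Proof (Deligne §5 / Shimura §8.3 «`S_Φ = ⊔_{σ} {τ | τ|_K = σ}`» read on eigenvectors):
  a primitive element `θ` of `E(t)/ℚ` acts semisimply on `ℂ ⊗ W(t)` (separable minimal polynomial; the tree's
  `HodgeStructure.iSup_eigenspace_baseChange_eq_top`), so `y = Σ_μ y_μ` over the eigenvalues `μ` of `ρ(θ)_ℂ`; on each
  `y_μ ≠ 0` the field `E(t) = ℚ[θ]` acts through an embedding `τ_μ : E(t) → ℂ`
  (`HodgeStructure.exists_ringHom_forall_baseChange_apply_eq_smul`); comparing with the `σ`-eigen-equation and using the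
  independence of the `y_μ` (`Module.End.eigenspaces_iSupIndep`) gives `τ_μ ∘ e = σ`; each `y_μ` is then a joint
  eigenvector of `τ_μ ∘ t` in `ℂ ⊗ V` (`eigenvector_subtype_of_eigenfieldAction`), of type `(1,0)` iff `τ_μ ∘ e = σ ∈ Ψ`.
* `allOrNothing_restrict_subfield` — the packaged (HE)-shape statement for the restricted action
  `(eigenfieldAction act t hocc).comp e : K →ₐ[ℚ] End_ℚ W(t)`.

Relies on: nothing unproved (axioms `propext`, `Classical.choice`, `Quot.sound`).

## References

* [Shimura1998] G. Shimura, *Abelian Varieties with Complex Multiplication and Modular Functions* (1998), §8.3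
  (the CM type induced to an overfield: «`Ψ = {τ | τ|_K ∈ Φ}`») and §24.15.
* [Deligne1982HodgeCycles] P. Deligne, *Hodge cycles on abelian varieties*, LNM 900 (1982), §4 (p. 30), §5.
* [Huybrechts2016K3] D. Huybrechts, *Lectures on K3 Surfaces* (2016), Rem. 3.3.14 (iii) (diagonalisation of a field
  of endomorphisms over `ℂ`; consumed through the tree file `Motives/HodgeStructureEndAlgDiagonalization`).

## Provenance

Cell `pub-hodgecm2` (COR-CM), count-neutral own lane ONETYPE-EIGEN-CMHOM of seat `pub-hodgecm2-b26` (gen 23), part 3.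
-/

noncomputable section

open scoped TensorProduct
open Module

namespace Literature.AlgebraicGeometry.ComplexMultiplication

open Literature.AlgebraicGeometry.Motives (CMType)

section Restrict

variable {R : Type*} [CommRing R] [Algebra ℚ R] {V : Type*} [AddCommGroup V] [Module ℚ V]
  [FiniteDimensional ℚ V]
  (H : Motives.HodgeStructure V 1) (act : R →ₐ[ℚ] Module.End ℚ V) (t : R →ₐ[ℚ] ℂ)

/-- **On the eigenblock, the eigenvalue field acts semisimply and through embeddings**: for a primitive element
`θ` of the number field `E(t)` (`ℚ⟮θ⟯ = ⊤`), the eigenspaces of `ρ(θ)_ℂ` span `ℂ ⊗ W(t)`, and on the `μ`-eigenspace the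
whole field acts through a ring homomorphism `τ : E(t) → ℂ` with `τ(θ) = μ` — the tree's diagonalisation of a field of
endomorphisms (`HodgeStructure.iSup_eigenspace_baseChange_eq_top`, `…exists_ringHom_forall_baseChange_apply_eq_smul`)
applied to `ρ(E(t)) ⊆ End_ℚ W(t)`. [cite: Huybrechts2016K3, Rem. 3.3.14 (iii)] [cite: Deligne1982HodgeCycles, §4 (p. 30)] -/
theorem eigenfieldAction_diagonal [NumberField (eigenfield t)]
    (hocc : ∃ x : ℂ ⊗[ℚ] V, x ≠ 0 ∧ ∀ a, (act a).baseChange ℂ x = t a • x)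
    {θ : eigenfield t} (hθ : IntermediateField.adjoin ℚ {θ} = ⊤) :
    (⨆ μ : ℂ, Module.End.eigenspace ((eigenfieldAction act t hocc θ).baseChange ℂ) μ) = ⊤ ∧
    ∀ μ : ℂ, Module.End.HasEigenvalue ((eigenfieldAction act t hocc θ).baseChange ℂ) μ →
      ∃ τ : eigenfield t →+* ℂ, τ θ = μ ∧
        ∀ (c : eigenfield t), ∀ x ∈ Module.End.eigenspace ((eigenfieldAction act t hocc θ).baseChange ℂ) μ,
          (eigenfieldAction act t hocc c).baseChange ℂ x = τ c • x := by
  set ρ := eigenfieldAction act t hocc with hρ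
  -- `ρ` is injective (a field acting on a non-zero space), so its range is a field `≅ E(t)`
  haveI : Nontrivial (eigenblock act t) := (Submodule.nontrivial_iff_ne_bot).2 (eigenblock_ne_bot act t hocc)
  have hinj : Function.Injective ρ := ρ.toRingHom.injective
  have hF : IsField ρ.range :=
    MulEquiv.isField (Field.toIsField (eigenfield t)) (AlgEquiv.ofInjective ρ hinj).symm.toMulEquiv
  -- every element of `E(t)` is a polynomial in `θ`
  have hgenE : ∀ c : eigenfield t, ∃ p : Polynomial ℚ, Polynomial.aeval θ p = c := fun c ↦ by
    have hc : c ∈ (Polynomial.aeval (R := ℚ) θ).range := by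
      rw [← Algebra.adjoin_singleton_eq_range_aeval,
        ← IntermediateField.adjoin_simple_toSubalgebra_of_isAlgebraic (Algebra.IsAlgebraic.isAlgebraic θ), hθ,
        IntermediateField.top_toSubalgebra]
      exact Algebra.mem_top
    exact hc
  let θ' : ρ.range := ⟨ρ θ, ⟨θ, rfl⟩⟩
  have hgen : ∀ b : ρ.range, ∃ p : Polynomial ℚ, Polynomial.aeval θ' p = b := by
    rintro ⟨b, hb⟩
    obtain ⟨c, rfl⟩ := ρ.mem_range.1 hb
    obtain ⟨p, hp⟩ := hgenE c
    refine ⟨p, Subtype.ext ?_⟩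
    change ρ.range.val (Polynomial.aeval θ' p) = ρ c
    rw [← Polynomial.aeval_algHom_apply ρ.range.val θ' p]
    show Polynomial.aeval (ρ θ) p = ρ c
    rw [Polynomial.aeval_algHom_apply ρ θ p, hp]
  refine ⟨Motives.HodgeStructure.iSup_eigenspace_baseChange_eq_top hF θ', fun μ hμ ↦ ?_⟩
  obtain ⟨φ, hφθ, hφ⟩ := Motives.HodgeStructure.exists_ringHom_forall_baseChange_apply_eq_smul θ' hgen hμ
  refine ⟨φ.comp ρ.rangeRestrict.toRingHom, ?_, fun c x hx ↦ ?_⟩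
  · show φ (ρ.rangeRestrict θ) = μ
    exact hφθ
  · exact hφ (ρ.rangeRestrict c) x hx

/-- **Restriction to a subfield along which the sign pattern is induced keeps the one-type property** (CM-type
inflation, [Shimura1998] §8.3; [Deligne1982HodgeCycles] §5).  Let `e : K → E(t)` embed a number field `K` into the
eigenvalue field and let `Ψ ⊆ Hom(K, ℂ)` be such that an embedding `τ` of `E(t)` is of type `(1,0)` iff `τ ∘ e ∈ Ψ`
(`hind`).  If `y ∈ ℂ ⊗ W(t)` is a `σ`-eigenvector for the RESTRICTED action `b ↦ ρ(e b)` (`σ : K → ℂ`), then, read in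
`ℂ ⊗ V`, `y` is of type `(1,0)` when `σ ∈ Ψ` and of type `(0,1)` when `σ ∉ Ψ`. [cite: Shimura1998, §8.3 and §24.15 Theorem]
[cite: Deligne1982HodgeCycles, §4–§5] -/
theorem oneType_restrict_subfield [NumberField (eigenfield t)]
    (hocc : ∃ x : ℂ ⊗[ℚ] V, x ≠ 0 ∧ ∀ a, (act a).baseChange ℂ x = t a • x)
    (hall : ∀ τ : eigenfield t →+* ℂ,
      (∀ x : ℂ ⊗[ℚ] V, (∀ a, (act a).baseChange ℂ x = τ ⟨t a, apply_mem_eigenfield t a⟩ • x) → x ∈ H.piece 1 0) ∨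
      (∀ x : ℂ ⊗[ℚ] V, (∀ a, (act a).baseChange ℂ x = τ ⟨t a, apply_mem_eigenfield t a⟩ • x) → x ∈ H.piece 0 1))
    {K : Type} [Field K] [NumberField K] (e : K →+* eigenfield t) (Ψ : Set (K →+* ℂ))
    (hind : ∀ τ : eigenfield t →+* ℂ,
      (∀ x : ℂ ⊗[ℚ] V, (∀ a, (act a).baseChange ℂ x = τ ⟨t a, apply_mem_eigenfield t a⟩ • x) → x ∈ H.piece 1 0) ↔
        τ.comp e ∈ Ψ)
    (σ : K →+* ℂ) {y : ℂ ⊗[ℚ] eigenblock act t}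
    (hy : ∀ b : K, (eigenfieldAction act t hocc (e b)).baseChange ℂ y = σ b • y) :
    (σ ∈ Ψ → (eigenblock act t).subtype.baseChange ℂ y ∈ H.piece 1 0) ∧
    (σ ∉ Ψ → (eigenblock act t).subtype.baseChange ℂ y ∈ H.piece 0 1) := by
  classical
  set ρ := eigenfieldAction act t hocc with hρ
  -- a primitive element of `E(t)` and the eigen-decomposition of `y` under `ρ(θ)_ℂ`
  obtain ⟨θ, hθ⟩ := Field.exists_primitive_element ℚ (eigenfield t)
  obtain ⟨htop, hchar⟩ := eigenfieldAction_diagonal act t hocc hθ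
  set T := (ρ θ).baseChange ℂ with hT
  obtain ⟨f, hf, hfy⟩ := (Submodule.mem_iSup_iff_exists_finsupp _ _).1
    (show y ∈ ⨆ μ : ℂ, Module.End.eigenspace T μ by rw [htop]; exact Submodule.mem_top)
  -- on each non-zero component the field acts through an embedding `τ_μ`
  have hev : ∀ μ : f.support, Module.End.HasEigenvalue T μ := fun μ ↦
    Module.End.hasEigenvalue_of_hasEigenvector ⟨hf μ, Finsupp.mem_support_iff.1 μ.2⟩
  choose τ hτθ hτ using fun μ : f.support ↦ hchar μ (hev μ)
  -- `y = Σ_μ f μ`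
  have hysum : y = ∑ μ : f.support, f μ := by
    rw [← hfy, Finsupp.sum, ← Finset.sum_coe_sort]
  -- comparing the `σ`-eigen-equation with the `τ_μ`-actions: `τ_μ (e b) = σ b`
  have hli : LinearIndependent ℂ (fun μ : f.support ↦ (f μ : ℂ ⊗[ℚ] eigenblock act t)) :=
    ((Module.End.eigenspaces_iSupIndep T).comp
        (Subtype.val_injective : Function.Injective (fun μ : f.support ↦ (μ : ℂ)))).linearIndependent _
      (fun μ : f.support ↦ hf (μ : ℂ)) (fun μ : f.support ↦ Finsupp.mem_support_iff.1 μ.2)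
  have hcoef : ∀ (b : K) (μ : f.support), τ μ (e b) = σ b := by
    intro b μ
    have hzero : ∑ ν : f.support, (τ ν (e b) - σ b) • (f ν : ℂ ⊗[ℚ] eigenblock act t) = 0 := by
      simp only [sub_smul, Finset.sum_sub_distrib]
      rw [← Finset.smul_sum, ← hysum, ← hy b, hysum, map_sum]
      refine sub_eq_zero.2 (Finset.sum_congr rfl fun ν _ ↦ ?_)
      exact (hτ ν (e b) (f ν) (hf ν)).symm
    have := (Fintype.linearIndependent_iff.1 hli) (fun ν ↦ τ ν (e b) - σ b) hzero μ
    exact sub_eq_zero.1 this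
  have hcomp : ∀ μ : f.support, (τ μ).comp e = σ := fun μ ↦ RingHom.ext fun b ↦ hcoef b μ
  -- each component, read in `ℂ ⊗ V`, is a joint eigenvector of `τ_μ ∘ t`
  have heig : ∀ (μ : f.support) (a : R),
      (act a).baseChange ℂ ((eigenblock act t).subtype.baseChange ℂ (f μ)) =
        τ μ ⟨t a, apply_mem_eigenfield t a⟩ • (eigenblock act t).subtype.baseChange ℂ (f μ) :=
    fun μ ↦ eigenvector_subtype_of_eigenfieldAction act t hocc (τ μ) fun c ↦ hτ μ c (f μ) (hf μ)
  have hsum : (eigenblock act t).subtype.baseChange ℂ y =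
      ∑ μ : f.support, (eigenblock act t).subtype.baseChange ℂ (f μ) := by
    rw [hysum, map_sum]
  refine ⟨fun hσ ↦ ?_, fun hσ ↦ ?_⟩
  · rw [hsum]
    refine Submodule.sum_mem _ fun μ _ ↦ ?_
    have h10 := (hind (τ μ)).2 (by rw [hcomp μ]; exact hσ)
    exact h10 _ (heig μ)
  · rw [hsum]
    refine Submodule.sum_mem _ fun μ _ ↦ ?_
    have h01 := (hall (τ μ)).resolve_left fun h ↦ hσ (by rw [← hcomp μ]; exact (hind (τ μ)).1 h)
    exact h01 _ (heig μ)

/-- **(HE)-shape packaging**: under the hypotheses of `oneType_restrict_subfield`, the RESTRICTED action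
`ρ ∘ e : K →ₐ[ℚ] End_ℚ W(t)` of the subfield `K` on the eigenblock is all-or-nothing with respect to `Ψ` — every joint
`σ`-eigenvector is of type `(1,0)` for `σ ∈ Ψ` and of type `(0,1)` for `σ ∉ Ψ` (route R-A, binder (HE), abstract form).
[cite: Shimura1998, §8.3 and §24.15 Theorem] [cite: Deligne1982HodgeCycles, §4–§5] -/
theorem allOrNothing_restrict_subfield [NumberField (eigenfield t)]
    (hocc : ∃ x : ℂ ⊗[ℚ] V, x ≠ 0 ∧ ∀ a, (act a).baseChange ℂ x = t a • x)
    (hall : ∀ τ : eigenfield t →+* ℂ,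
      (∀ x : ℂ ⊗[ℚ] V, (∀ a, (act a).baseChange ℂ x = τ ⟨t a, apply_mem_eigenfield t a⟩ • x) → x ∈ H.piece 1 0) ∨
      (∀ x : ℂ ⊗[ℚ] V, (∀ a, (act a).baseChange ℂ x = τ ⟨t a, apply_mem_eigenfield t a⟩ • x) → x ∈ H.piece 0 1))
    {K : Type} [Field K] [NumberField K] (e : K →+* eigenfield t) (Ψ : Set (K →+* ℂ))
    (hind : ∀ τ : eigenfield t →+* ℂ,
      (∀ x : ℂ ⊗[ℚ] V, (∀ a, (act a).baseChange ℂ x = τ ⟨t a, apply_mem_eigenfield t a⟩ • x) → x ∈ H.piece 1 0) ↔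
        τ.comp e ∈ Ψ)
    (σ : K →+* ℂ) :
    (σ ∈ Ψ → ∀ y : ℂ ⊗[ℚ] eigenblock act t,
      (∀ b : K, (((eigenfieldAction act t hocc).comp e.toRatAlgHom) b).baseChange ℂ y = σ b • y) →
        (eigenblock act t).subtype.baseChange ℂ y ∈ H.piece 1 0) ∧
    (σ ∉ Ψ → ∀ y : ℂ ⊗[ℚ] eigenblock act t,
      (∀ b : K, (((eigenfieldAction act t hocc).comp e.toRatAlgHom) b).baseChange ℂ y = σ b • y) →
        (eigenblock act t).subtype.baseChange ℂ y ∈ H.piece 0 1) :=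
  ⟨fun hσ _ hy ↦ (oneType_restrict_subfield H act t hocc hall e Ψ hind σ (fun b ↦ by simpa using hy b)).1 hσ,
    fun hσ _ hy ↦ (oneType_restrict_subfield H act t hocc hall e Ψ hind σ (fun b ↦ by simpa using hy b)).2 hσ⟩

end Restrict

end Literature.AlgebraicGeometry.ComplexMultiplication

end
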